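import Summits.QuantumFields.BalabanUV.T4Continuum.Spine.NE1p.DressedSmallFieldRecordLabelsKillWitnessEnd

/-!
# T⁴ programme, spine estimate NE1′ (node O3b/H2) — WITNESS «N1a FIRES AT THE CARRIERS OF RECORD», PART 3: the attached END's bounded
# quantity is NOT ZERO (the owner-filtered catalogue sum at `X₀` is ONE live masked Gaussian activity, in closed form), and the schema is
# inhabited HYPOTHESIS-FREE at the substrate's driven two-run object of record at `SU(2)`

Cell `pub-balaban`, sub-cell `t4`, BINDER-OWNERS row NE1′; NE1′ formalisation crew, unit `b2b-balaban-t4-ne1p-formalise-leaf-04`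
(gen 17); crew row **W96 ∕ DAG N29zzzzzi** PART 3 of 3 (D1) of `t4/formal/NE1p/LEAVES.md` (BOOKED typer R-T151, `HOME/CLAIMS.log`
l.24469; INTENT l.24458; read X239).  ADDITIVE — imports
PART 2 `Spine/NE1p/DressedSmallFieldRecordLabelsKillWitnessEnd` ONLY (→ PART 1 → W91, W58 P2); THEOREMS ONLY (0 def, 0 `def … : Prop`,
0 cite, 0 sorry, 0 `attribute`); no END of the owner's is fired here (PART 2 fires them); W58 P2's `actOfLetters_zero_closed`, W24's
`exp_locE_cube`, PART 1's `actOfLetters_ℓK` ∕ `labK_mem_filter` ∕ `factor_eq_pK_iff` ∕ `cK_pos` ∕ `cK_lt_one` BY NAME; nothing restated.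

WHAT.
* §7 GENUINE: **`filteredSum_X₀`** — the owner-filtered catalogue sum of `ℓK`'s activities of record at `X₀` IS
  `cK·(e^{V″(h)(⟨k+1, X₀⟩, 0)} − 1)` (`Finset.sum_eq_single_of_mem` at `labK` — every other filtered label's factor is off `pK` by
  `InnerLabel.ofTorus_injective` and its masked activity is `0`; at `labK`, `actOfLetters_ℓK` + W58 P2 `actOfLetters_zero_closed`); dressed
  (`0 + wW D`) `= cK·(e^{sW} − 1)`, undressed `= 0`, both strictly inside the unit disc; **`filteredSum_live`**; hence
  **`killWitnessEnd_live`**: the attached END's bounded `locE` difference is NOT zero (W24 `exp_locE_cube` BY NAME); §7b along road P1's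
  source pencil: `filteredSum_pencil` (`= cK·(e^{s·sW} − 1)` at every complex `s`) and **`killWitnessMuEnd_live`** — the μ-END's quantity is NOT
  zero at any real source `0 < t ≤ 1`.
* §8 **HYPOTHESIS-FREE at `SU(2)`**: at W58 P2 §7's `DW := drivenRecordSU (n := Fin 2) F13 0 0 1 1` (`F13`: `L = 13`, `m = 1`; `K = 0`,
  `m′ = 0`) the standing-scale premiss at `k = 0` is `0 + 1 + 0 ≤ 1 + 0` (**`hk_DW`**, `decide`); **`killWitnessEnd_fires_SU2`** (PART 2's
  closed form `≤ 2·K₀(64,8)` at `D := DW`, `U := UW`) and **`killWitnessEnd_live_SU2`** — no hypothesis left.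

HONEST FRAMING.  As PARTS 1–2: a DECIDED TOY ([folklore]) — OWNER RIDER (r1) (g38 l.24548,
verbatim): «kill BY MASK χ = 𝟙_{p⋆}·cK — OURS, by fiat, exactly as W91's `killConv`; (B1b) NOT claimed; `hAmp` MET BY CHOICE of `cK` = N0y's
one-family majorant factor — (B3-form) UNPRINTED for Bałaban's cores (G-ne9p2-5)»; (r2) `labK`'s filter membership is the lattice lemma
`mem_torusLabels_iff` + `image_tcoarse_trefine` (family branch `P = ∅`, `#(Z₀ ∖ ∪fam) = 0 ≤ 2·0`), NOT a reading of p. 12 ∕ p. 18; (r3) a crew W-row —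
the owner's N1b (a kill predicate READ FROM PRINT) stays RESERVED.  W58's OWN 1×1 Gaussian letters at ONE factor of record, every other factor's
normalisation letter masked to `0` BY FIAT; the liveness is about THIS toy's logarithm `log(1 + cK(e^{sW} − 1))` — nothing about which of
Bałaban's (2.14) terms survive at a polymer; (B1b) NOT claimed; (B3-form) MET because `cK` is CHOSEN as N0y's majorant factor — UNPRINTED for
Bałaban's cores (GAPS G-ne9p2-5); every numeral OURS over pv22's located `K₀(64,8)`∕`64 log 162`; 0 binders instantiated on Bałaban's (2.14)
densities; no wall item; wall v1.8 (T4-DAG v48–v54) — words, not kind — does NOT move; R-t4r2-Q2 NOT met thereby; NE1′ ⇐ the named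
binders — NOT printed, NOT proved; spine PROVED 0∕9; count 9 unchanged.  ABSOLUTE RULE honoured.  Rung (B)+1 on ONE finite four-torus —
NOT infinite volume, NOT a mass gap, NOT OS on ℝ⁴, NOT Clay.  HONEST DEPENDENCY: continuum YM on T⁴ ⇐ BetaPertH ∧ nine spine estimates
(0/9 proved); BetaPertH ⇐ (D1) ∧ (D4) ∧ CAP+tail; G-an2-4 gates asym, D1 and NE2/3/4.
-/

noncomputable section

namespace Summit.QuantumFields.BalabanUV.T4Continuum.NE1p.DressedSmallFieldRecordLabelsKillWitness

open Set Metric MeasureTheory Complex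
open scoped BigOperators
open Literature.MathematicalPhysics.QuantumFieldTheory.Balaban1983to89
open Literature.MathematicalPhysics.QuantumFieldTheory.Balaban1983to89.B12TreeDecay (K₀ K₀_pos)
open Literature.MathematicalPhysics.QuantumFieldTheory.Balaban1983to89.B13Resummation (locE)
open Literature.MathematicalPhysics.QuantumFieldTheory.Balaban1983to89.TreeLengthTorus (TPt TDom tsys torusTreeLen torusTreeLen_singleton
  torusTreeLen_nonneg)
open Literature.MathematicalPhysics.QuantumFieldTheory.Balaban1983to89.TreeLengthTorusGeometry (tgeometry TTouch)
open Literature.MathematicalPhysics.QuantumFieldTheory.Balaban1983to89.T4WindowLevelShift.Sanity (F13)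
open Summit.QuantumFields.BalabanUV.T4Continuum.B13HistDatum (level136)
open Summit.QuantumFields.BalabanUV.T4Continuum.B13HistMeasurable (MeasPotFrame B13HistM)
open Summit.QuantumFields.BalabanUV.T4Continuum.B13HistReadout (VppCLMM VppCLMM_apply)
open Summit.QuantumFields.BalabanUV.T4Continuum.B13HistWitness (toyConsts toy_posUnits level136_toy)
open Summit.QuantumFields.BalabanUV.T4Continuum.B13Carriers (TwoRuns singleDom singleDom_val)
open Summit.QuantumFields.BalabanUV.T4Continuum.B13StepTermLabels (InnerLabel innerLabels)
open Summit.QuantumFields.BalabanUV.T4Continuum.B13InnerData (Bnd b13InnerData)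
open Summit.QuantumFields.BalabanUV.T4Continuum.B13DomainGeometryTR (domEmb domEmb_apply)
open Summit.QuantumFields.BalabanUV.T4Continuum.SubstrateTwoRunsDriven (DrivenRuns)
open Summit.QuantumFields.BalabanUV.T4Continuum.SubstrateBlockAvgContinuity (drivenRecordSU one_mem_domV_drivenRecordSU)
open Summit.QuantumFields.BalabanUV.T4Continuum.SubstrateActivities (CoreLetters coreOf actOfLetters actOfLetters_apply)
open Summit.QuantumFields.BalabanUV.T4Continuum.SubstrateNestedToriOfRecord (InnerLabel.ofTorus InnerLabel.ofTorus_injective torusLabels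
  mem_torusLabels_iff fineEmb)
open Summit.QuantumFields.BalabanUV.T4Continuum.SubstrateBondsOfCubes (bondsOfFineCubes)
open Summit.QuantumFields.BalabanUV.T4Continuum.TorusBlockRefinement (trefineDom trefineDom_val image_tcoarse_trefine)
open Summit.QuantumFields.BalabanUV.T4Continuum.NE1p.DressedSmallFieldCoresWitness (E1 Acst Acst_pos)
open Summit.QuantumFields.BalabanUV.T4Continuum.NE1p.DressedSmallFieldTorusWitness (X₀ X₀_val eq_X₀_iff hrate_torus_num exp_locE_cube)
open Summit.QuantumFields.BalabanUV.T4Continuum.NE1p.DressedSmallFieldSlotLettersWitness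
open Summit.QuantumFields.BalabanUV.T4Continuum.NE1p.DressedSmallFieldSlotLettersWitnessEnd
open Summit.QuantumFields.BalabanUV.T4Continuum.NE1p.DressedSmallFieldRecordLabelsKillConvention
  (attachedPart_locE_le_of_actOfLetters_recordLabels_any muPart_locE_le_of_actOfLetters_recordLabels_any)

variable {G : Type} [GaugeGroup G] (D : DrivenRuns G) (k : ℕ) (hk : k + 1 + D.m' ≤ D.F.m + D.K)

/-! ## §7 GENUINE: the owner-filtered catalogue sum at `X₀` is the ONE live masked activity — and it is NOT zero -/

open Classical in
/-- **THE OWNER-FILTERED CATALOGUE SUM OF `ℓK`'s ACTIVITIES AT `X₀`, IN CLOSED FORM** [decided toy]: `= cK·(e^{V″(h)(⟨k+1, X₀⟩, 0)} − 1)` —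
the sum collapses to `labK` (every other filtered label's factor is off `pK`, `InnerLabel.ofTorus_injective`), where `actOfLetters_ℓK` and
W58 P2's `actOfLetters_zero_closed` give the value. [folklore] -/
theorem filteredSum_X₀ (h : B13HistM (PW D)) :
    (fun Z => ∑ ℓ ∈ (torusLabels hk Z).filter fun ℓ =>
              ℓ.Z₀ = trefineDom D.F.L (D.cubesPerDir (k + 1)) Z ∧
                ℓ.P ⊆ bondsOfFineCubes hk (ℓ.Z₀.1 \ ℓ.fam.biUnion fun Y : (tsys 4 (D.F.L * D.cubesPerDir (k + 1))).Dom => Y.1) ∧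
                (ℓ.Z₀.1 \ ℓ.fam.biUnion fun Y : (tsys 4 (D.F.L * D.cubesPerDir (k + 1))).Dom => Y.1).card ≤ 2 * ℓ.P.card,
            actOfLetters (PW D) ℂ (𝒵K D) (domK D) (JcK D) (VK D) (ℓK D k hk) (domEmb D.toTwoRuns (k + 1) Z) (InnerLabel.ofTorus hk ℓ) 0
              h) (X₀ (D.cubesPerDir (k + 1))) =
      (cK D k : ℂ) * (cexp ((PW D).VppM h (domEmb D.toTwoRuns (k + 1) (X₀ (D.cubesPerDir (k + 1)))) (fun _ => (0 : ℝ))) - 1) := by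
  simp only []
  rw [Finset.sum_eq_single_of_mem (labK D k) (labK_mem_filter D k hk) (fun ℓ _ hne => by
    rw [actOfLetters_ℓK, χK_of_ne D k hk (fun h => hne ((factor_eq_pK_iff D k hk ℓ).1 h)), Complex.ofReal_zero, zero_mul])]
  rw [actOfLetters_ℓK, actOfLetters_zero_closed]
  show (χK D k hk (pK D k hk) : ℂ) * _ = _
  rw [χK_pK]

/-- The dressed table `0 + wW D` reads `sW` at the embedded one-cube domain (linearity of the read-out, `VppM_tabW`, `d = 0`). [folklore] -/
theorem VppM_dressed_X₀ :
    (PW D).VppM ((0 : B13HistM (PW D)) + wW D) (domEmb D.toTwoRuns (k + 1) (X₀ (D.cubesPerDir (k + 1)))) (fun _ => (0 : ℝ)) = (sW : ℂ) := by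
  rw [zero_add, wW, ← VppCLMM_apply, map_smul, VppCLMM_apply, VppM_tabW, d_domEmb_X₀, level136_toy, smul_eq_mul]; simp

/-- The undressed table reads `0`. [folklore] -/
theorem VppM_zero_X₀ : (PW D).VppM (0 : B13HistM (PW D)) (domEmb D.toTwoRuns (k + 1) (X₀ (D.cubesPerDir (k + 1)))) (fun _ => (0 : ℝ)) = 0 := by
  rw [← VppCLMM_apply, map_zero]

open Classical in
/-- **DRESSED VALUE**: the filtered catalogue sum at the dressed table is `cK·(e^{sW} − 1)`. [folklore] -/
theorem filteredSum_dressed :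
    (fun Z => ∑ ℓ ∈ (torusLabels hk Z).filter fun ℓ =>
              ℓ.Z₀ = trefineDom D.F.L (D.cubesPerDir (k + 1)) Z ∧
                ℓ.P ⊆ bondsOfFineCubes hk (ℓ.Z₀.1 \ ℓ.fam.biUnion fun Y : (tsys 4 (D.F.L * D.cubesPerDir (k + 1))).Dom => Y.1) ∧
                (ℓ.Z₀.1 \ ℓ.fam.biUnion fun Y : (tsys 4 (D.F.L * D.cubesPerDir (k + 1))).Dom => Y.1).card ≤ 2 * ℓ.P.card,
            actOfLetters (PW D) ℂ (𝒵K D) (domK D) (JcK D) (VK D) (ℓK D k hk) (domEmb D.toTwoRuns (k + 1) Z) (InnerLabel.ofTorus hk ℓ) 0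
              ((0 : B13HistM (PW D)) + wW D)) (X₀ (D.cubesPerDir (k + 1))) = ((cK D k * (Real.exp sW - 1) : ℝ) : ℂ) := by
  rw [filteredSum_X₀, VppM_dressed_X₀]; push_cast; rfl

open Classical in
/-- **UNDRESSED VALUE**: `0`. [folklore] -/
theorem filteredSum_undressed :
    (fun Z => ∑ ℓ ∈ (torusLabels hk Z).filter fun ℓ =>
              ℓ.Z₀ = trefineDom D.F.L (D.cubesPerDir (k + 1)) Z ∧
                ℓ.P ⊆ bondsOfFineCubes hk (ℓ.Z₀.1 \ ℓ.fam.biUnion fun Y : (tsys 4 (D.F.L * D.cubesPerDir (k + 1))).Dom => Y.1) ∧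
                (ℓ.Z₀.1 \ ℓ.fam.biUnion fun Y : (tsys 4 (D.F.L * D.cubesPerDir (k + 1))).Dom => Y.1).card ≤ 2 * ℓ.P.card,
            actOfLetters (PW D) ℂ (𝒵K D) (domK D) (JcK D) (VK D) (ℓK D k hk) (domEmb D.toTwoRuns (k + 1) Z) (InnerLabel.ofTorus hk ℓ) 0
              (0 : B13HistM (PW D))) (X₀ (D.cubesPerDir (k + 1))) = 0 := by
  rw [filteredSum_X₀, VppM_zero_X₀, Complex.exp_zero, sub_self, mul_zero]

open Classical in
/-- **THE ATTACHED PART OF THE FILTERED CATALOGUE SUM IS NOT ZERO** (`cK > 0`, `e^{sW} − 1 > 0`). [folklore] -/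
theorem filteredSum_live :
    (fun Z => ∑ ℓ ∈ (torusLabels hk Z).filter fun ℓ =>
              ℓ.Z₀ = trefineDom D.F.L (D.cubesPerDir (k + 1)) Z ∧
                ℓ.P ⊆ bondsOfFineCubes hk (ℓ.Z₀.1 \ ℓ.fam.biUnion fun Y : (tsys 4 (D.F.L * D.cubesPerDir (k + 1))).Dom => Y.1) ∧
                (ℓ.Z₀.1 \ ℓ.fam.biUnion fun Y : (tsys 4 (D.F.L * D.cubesPerDir (k + 1))).Dom => Y.1).card ≤ 2 * ℓ.P.card,
            actOfLetters (PW D) ℂ (𝒵K D) (domK D) (JcK D) (VK D) (ℓK D k hk) (domEmb D.toTwoRuns (k + 1) Z) (InnerLabel.ofTorus hk ℓ) 0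
              ((0 : B13HistM (PW D)) + wW D)) (X₀ (D.cubesPerDir (k + 1))) ≠
      (fun Z => ∑ ℓ ∈ (torusLabels hk Z).filter fun ℓ =>
              ℓ.Z₀ = trefineDom D.F.L (D.cubesPerDir (k + 1)) Z ∧
                ℓ.P ⊆ bondsOfFineCubes hk (ℓ.Z₀.1 \ ℓ.fam.biUnion fun Y : (tsys 4 (D.F.L * D.cubesPerDir (k + 1))).Dom => Y.1) ∧
                (ℓ.Z₀.1 \ ℓ.fam.biUnion fun Y : (tsys 4 (D.F.L * D.cubesPerDir (k + 1))).Dom => Y.1).card ≤ 2 * ℓ.P.card,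
            actOfLetters (PW D) ℂ (𝒵K D) (domK D) (JcK D) (VK D) (ℓK D k hk) (domEmb D.toTwoRuns (k + 1) Z) (InnerLabel.ofTorus hk ℓ) 0
              (0 : B13HistM (PW D))) (X₀ (D.cubesPerDir (k + 1))) := by
  rw [filteredSum_dressed, filteredSum_undressed, Ne, Complex.ofReal_eq_zero]
  exact (mul_pos (cK_pos D k) dressed_value_pos_lt_one.1).ne'

open Classical in
/-- Both values are STRICTLY inside the unit disc (`cK < 1`, `e^{sW} − 1 < 1`), so W24's `exp_locE_cube` applies. [folklore] -/
theorem norm_filteredSum_lt_one :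
    ‖(fun Z => ∑ ℓ ∈ (torusLabels hk Z).filter fun ℓ =>
              ℓ.Z₀ = trefineDom D.F.L (D.cubesPerDir (k + 1)) Z ∧
                ℓ.P ⊆ bondsOfFineCubes hk (ℓ.Z₀.1 \ ℓ.fam.biUnion fun Y : (tsys 4 (D.F.L * D.cubesPerDir (k + 1))).Dom => Y.1) ∧
                (ℓ.Z₀.1 \ ℓ.fam.biUnion fun Y : (tsys 4 (D.F.L * D.cubesPerDir (k + 1))).Dom => Y.1).card ≤ 2 * ℓ.P.card,
            actOfLetters (PW D) ℂ (𝒵K D) (domK D) (JcK D) (VK D) (ℓK D k hk) (domEmb D.toTwoRuns (k + 1) Z) (InnerLabel.ofTorus hk ℓ) 0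
              ((0 : B13HistM (PW D)) + wW D)) (X₀ (D.cubesPerDir (k + 1)))‖ < 1 ∧
      ‖(fun Z => ∑ ℓ ∈ (torusLabels hk Z).filter fun ℓ =>
              ℓ.Z₀ = trefineDom D.F.L (D.cubesPerDir (k + 1)) Z ∧
                ℓ.P ⊆ bondsOfFineCubes hk (ℓ.Z₀.1 \ ℓ.fam.biUnion fun Y : (tsys 4 (D.F.L * D.cubesPerDir (k + 1))).Dom => Y.1) ∧
                (ℓ.Z₀.1 \ ℓ.fam.biUnion fun Y : (tsys 4 (D.F.L * D.cubesPerDir (k + 1))).Dom => Y.1).card ≤ 2 * ℓ.P.card,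
            actOfLetters (PW D) ℂ (𝒵K D) (domK D) (JcK D) (VK D) (ℓK D k hk) (domEmb D.toTwoRuns (k + 1) Z) (InnerLabel.ofTorus hk ℓ) 0
              (0 : B13HistM (PW D))) (X₀ (D.cubesPerDir (k + 1)))‖ < 1 := by
  refine ⟨?_, by rw [filteredSum_undressed, norm_zero]; exact one_pos⟩
  rw [filteredSum_dressed, Complex.norm_real, Real.norm_eq_abs,
    abs_of_pos (mul_pos (cK_pos D k) dressed_value_pos_lt_one.1)]
  calc cK D k * (Real.exp sW - 1) < 1 * 1 :=
        mul_lt_mul'' (cK_lt_one D k) dressed_value_pos_lt_one.2 (cK_pos D k).le dressed_value_pos_lt_one.1.le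
    _ = 1 := one_mul 1

open Classical in
/-- **THE ATTACHED END's BOUNDED QUANTITY IS NOT ZERO** [decided toy]: the dressed small-field outputs of the owner-filtered catalogue sums
at the dressed table `0 + wW D` and at the undressed table `0` DIFFER at `X₀` — W24's `exp_locE_cube` BY NAME turns equal outputs into
equal polymer functionals at `X₀`, contradicting `filteredSum_live`. [folklore] -/
theorem killWitnessEnd_live :
    locE (tgeometry 4 (D.cubesPerDir (k + 1))).ι (tgeometry 4 (D.cubesPerDir (k + 1))).cubes
          (fun Z => ∑ ℓ ∈ (torusLabels hk Z).filter fun ℓ =>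
              ℓ.Z₀ = trefineDom D.F.L (D.cubesPerDir (k + 1)) Z ∧
                ℓ.P ⊆ bondsOfFineCubes hk (ℓ.Z₀.1 \ ℓ.fam.biUnion fun Y : (tsys 4 (D.F.L * D.cubesPerDir (k + 1))).Dom => Y.1) ∧
                (ℓ.Z₀.1 \ ℓ.fam.biUnion fun Y : (tsys 4 (D.F.L * D.cubesPerDir (k + 1))).Dom => Y.1).card ≤ 2 * ℓ.P.card,
            actOfLetters (PW D) ℂ (𝒵K D) (domK D) (JcK D) (VK D) (ℓK D k hk) (domEmb D.toTwoRuns (k + 1) Z) (InnerLabel.ofTorus hk ℓ) 0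
              ((0 : B13HistM (PW D)) + wW D))
            ((tgeometry 4 (D.cubesPerDir (k + 1))).cubes (X₀ (D.cubesPerDir (k + 1)))) ≠
      locE (tgeometry 4 (D.cubesPerDir (k + 1))).ι (tgeometry 4 (D.cubesPerDir (k + 1))).cubes
          (fun Z => ∑ ℓ ∈ (torusLabels hk Z).filter fun ℓ =>
              ℓ.Z₀ = trefineDom D.F.L (D.cubesPerDir (k + 1)) Z ∧
                ℓ.P ⊆ bondsOfFineCubes hk (ℓ.Z₀.1 \ ℓ.fam.biUnion fun Y : (tsys 4 (D.F.L * D.cubesPerDir (k + 1))).Dom => Y.1) ∧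
                (ℓ.Z₀.1 \ ℓ.fam.biUnion fun Y : (tsys 4 (D.F.L * D.cubesPerDir (k + 1))).Dom => Y.1).card ≤ 2 * ℓ.P.card,
            actOfLetters (PW D) ℂ (𝒵K D) (domK D) (JcK D) (VK D) (ℓK D k hk) (domEmb D.toTwoRuns (k + 1) Z) (InnerLabel.ofTorus hk ℓ) 0
              (0 : B13HistM (PW D)))
            ((tgeometry 4 (D.cubesPerDir (k + 1))).cubes (X₀ (D.cubesPerDir (k + 1)))) := by
  intro h
  have h1 : cexp (locE (tgeometry 4 (D.cubesPerDir (k + 1))).ι (tgeometry 4 (D.cubesPerDir (k + 1))).cubes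
          (fun Z => ∑ ℓ ∈ (torusLabels hk Z).filter fun ℓ =>
              ℓ.Z₀ = trefineDom D.F.L (D.cubesPerDir (k + 1)) Z ∧
                ℓ.P ⊆ bondsOfFineCubes hk (ℓ.Z₀.1 \ ℓ.fam.biUnion fun Y : (tsys 4 (D.F.L * D.cubesPerDir (k + 1))).Dom => Y.1) ∧
                (ℓ.Z₀.1 \ ℓ.fam.biUnion fun Y : (tsys 4 (D.F.L * D.cubesPerDir (k + 1))).Dom => Y.1).card ≤ 2 * ℓ.P.card,
            actOfLetters (PW D) ℂ (𝒵K D) (domK D) (JcK D) (VK D) (ℓK D k hk) (domEmb D.toTwoRuns (k + 1) Z) (InnerLabel.ofTorus hk ℓ) 0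
              ((0 : B13HistM (PW D)) + wW D))
            ((tgeometry 4 (D.cubesPerDir (k + 1))).cubes (X₀ (D.cubesPerDir (k + 1))))) = 1 + (fun Z => ∑ ℓ ∈ (torusLabels hk Z).filter fun ℓ =>
              ℓ.Z₀ = trefineDom D.F.L (D.cubesPerDir (k + 1)) Z ∧
                ℓ.P ⊆ bondsOfFineCubes hk (ℓ.Z₀.1 \ ℓ.fam.biUnion fun Y : (tsys 4 (D.F.L * D.cubesPerDir (k + 1))).Dom => Y.1) ∧
                (ℓ.Z₀.1 \ ℓ.fam.biUnion fun Y : (tsys 4 (D.F.L * D.cubesPerDir (k + 1))).Dom => Y.1).card ≤ 2 * ℓ.P.card,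
            actOfLetters (PW D) ℂ (𝒵K D) (domK D) (JcK D) (VK D) (ℓK D k hk) (domEmb D.toTwoRuns (k + 1) Z) (InnerLabel.ofTorus hk ℓ) 0
              ((0 : B13HistM (PW D)) + wW D)) (X₀ (D.cubesPerDir (k + 1))) :=
    exp_locE_cube (D.cubesPerDir (k + 1)) (norm_filteredSum_lt_one D k hk).1
  have h0 : cexp (locE (tgeometry 4 (D.cubesPerDir (k + 1))).ι (tgeometry 4 (D.cubesPerDir (k + 1))).cubes
          (fun Z => ∑ ℓ ∈ (torusLabels hk Z).filter fun ℓ =>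
              ℓ.Z₀ = trefineDom D.F.L (D.cubesPerDir (k + 1)) Z ∧
                ℓ.P ⊆ bondsOfFineCubes hk (ℓ.Z₀.1 \ ℓ.fam.biUnion fun Y : (tsys 4 (D.F.L * D.cubesPerDir (k + 1))).Dom => Y.1) ∧
                (ℓ.Z₀.1 \ ℓ.fam.biUnion fun Y : (tsys 4 (D.F.L * D.cubesPerDir (k + 1))).Dom => Y.1).card ≤ 2 * ℓ.P.card,
            actOfLetters (PW D) ℂ (𝒵K D) (domK D) (JcK D) (VK D) (ℓK D k hk) (domEmb D.toTwoRuns (k + 1) Z) (InnerLabel.ofTorus hk ℓ) 0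
              (0 : B13HistM (PW D)))
            ((tgeometry 4 (D.cubesPerDir (k + 1))).cubes (X₀ (D.cubesPerDir (k + 1))))) = 1 + (fun Z => ∑ ℓ ∈ (torusLabels hk Z).filter fun ℓ =>
              ℓ.Z₀ = trefineDom D.F.L (D.cubesPerDir (k + 1)) Z ∧
                ℓ.P ⊆ bondsOfFineCubes hk (ℓ.Z₀.1 \ ℓ.fam.biUnion fun Y : (tsys 4 (D.F.L * D.cubesPerDir (k + 1))).Dom => Y.1) ∧
                (ℓ.Z₀.1 \ ℓ.fam.biUnion fun Y : (tsys 4 (D.F.L * D.cubesPerDir (k + 1))).Dom => Y.1).card ≤ 2 * ℓ.P.card,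
            actOfLetters (PW D) ℂ (𝒵K D) (domK D) (JcK D) (VK D) (ℓK D k hk) (domEmb D.toTwoRuns (k + 1) Z) (InnerLabel.ofTorus hk ℓ) 0
              (0 : B13HistM (PW D))) (X₀ (D.cubesPerDir (k + 1))) :=
    exp_locE_cube (D.cubesPerDir (k + 1)) (norm_filteredSum_lt_one D k hk).2
  have h' := congrArg cexp h
  rw [h1, h0, add_right_inj] at h'
  exact filteredSum_live D k hk h'

/-! ## §7b GENUINE along road P1's source pencil: the μ-END's bounded quantity is NOT zero at any real source `0 < t ≤ 1` -/

/-- The table along the source pencil `0 + s • wW D` reads `s·sW` at the embedded one-cube domain (linearity of the read-out). [folklore] -/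
theorem VppM_pencil_X₀ (s : ℂ) :
    (PW D).VppM ((0 : B13HistM (PW D)) + s • wW D) (domEmb D.toTwoRuns (k + 1) (X₀ (D.cubesPerDir (k + 1)))) (fun _ => (0 : ℝ)) = s * (sW : ℂ) := by
  have h := VppM_dressed_X₀ D k
  rw [zero_add] at h
  rw [zero_add, ← VppCLMM_apply, map_smul, VppCLMM_apply, h, smul_eq_mul]

open Classical in
/-- **THE FILTERED CATALOGUE SUM ALONG THE SOURCE PENCIL, IN CLOSED FORM**: `cK·(e^{s·sW} − 1)` at every complex source `s`. [folklore] -/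
theorem filteredSum_pencil (s : ℂ) :
    (fun Z => ∑ ℓ ∈ (torusLabels hk Z).filter fun ℓ =>
              ℓ.Z₀ = trefineDom D.F.L (D.cubesPerDir (k + 1)) Z ∧
                ℓ.P ⊆ bondsOfFineCubes hk (ℓ.Z₀.1 \ ℓ.fam.biUnion fun Y : (tsys 4 (D.F.L * D.cubesPerDir (k + 1))).Dom => Y.1) ∧
                (ℓ.Z₀.1 \ ℓ.fam.biUnion fun Y : (tsys 4 (D.F.L * D.cubesPerDir (k + 1))).Dom => Y.1).card ≤ 2 * ℓ.P.card,
            actOfLetters (PW D) ℂ (𝒵K D) (domK D) (JcK D) (VK D) (ℓK D k hk) (domEmb D.toTwoRuns (k + 1) Z) (InnerLabel.ofTorus hk ℓ) 0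
              ((0 : B13HistM (PW D)) + s • wW D)) (X₀ (D.cubesPerDir (k + 1))) = (cK D k : ℂ) * (cexp (s * (sW : ℂ)) - 1) := by
  rw [filteredSum_X₀, VppM_pencil_X₀]

open Classical in
/-- … at a REAL source `t`: the real number `cK·(e^{t·sW} − 1)`. [folklore] -/
theorem filteredSum_pencil_real (t : ℝ) :
    (fun Z => ∑ ℓ ∈ (torusLabels hk Z).filter fun ℓ =>
              ℓ.Z₀ = trefineDom D.F.L (D.cubesPerDir (k + 1)) Z ∧
                ℓ.P ⊆ bondsOfFineCubes hk (ℓ.Z₀.1 \ ℓ.fam.biUnion fun Y : (tsys 4 (D.F.L * D.cubesPerDir (k + 1))).Dom => Y.1) ∧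
                (ℓ.Z₀.1 \ ℓ.fam.biUnion fun Y : (tsys 4 (D.F.L * D.cubesPerDir (k + 1))).Dom => Y.1).card ≤ 2 * ℓ.P.card,
            actOfLetters (PW D) ℂ (𝒵K D) (domK D) (JcK D) (VK D) (ℓK D k hk) (domEmb D.toTwoRuns (k + 1) Z) (InnerLabel.ofTorus hk ℓ) 0
              ((0 : B13HistM (PW D)) + ((t : ℝ) : ℂ) • wW D)) (X₀ (D.cubesPerDir (k + 1))) = ((cK D k * (Real.exp (t * sW) - 1) : ℝ) : ℂ) := by
  rw [filteredSum_pencil]; push_cast; rfl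

/-- `0 < e^{t·sW} − 1 < 1` for `0 < t ≤ 1` (`0 < sW ≤ 1∕64`). [folklore] -/
theorem pencil_value_pos_lt_one {t : ℝ} (ht0 : 0 < t) (ht1 : t ≤ 1) : 0 < Real.exp (t * sW) - 1 ∧ Real.exp (t * sW) - 1 < 1 := by
  have hs := sW_pos
  have h1 : 0 < t * sW := mul_pos ht0 hs
  refine ⟨by linarith [Real.add_one_lt_exp h1.ne'], ?_⟩
  have h2 : Real.exp (t * sW) ≤ Real.exp sW := Real.exp_le_exp.2 (by nlinarith)
  linarith [dressed_value_pos_lt_one.2]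

open Classical in
/-- **THE μ-END's BOUNDED QUANTITY IS NOT ZERO ON THE PUNCTURED REAL WINDOW** [decided toy]: for a real source `0 < t ≤ 1` the dressed
small-field outputs of the owner-filtered catalogue sums at `0 + t • wW D` and at `0` DIFFER at `X₀` (W24 `exp_locE_cube` BY NAME twice;
the pencil value `cK·(e^{t·sW} − 1) > 0`). [folklore] -/
theorem killWitnessMuEnd_live {t : ℝ} (ht0 : 0 < t) (ht1 : t ≤ 1) :
    locE (tgeometry 4 (D.cubesPerDir (k + 1))).ι (tgeometry 4 (D.cubesPerDir (k + 1))).cubes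
          (fun Z => ∑ ℓ ∈ (torusLabels hk Z).filter fun ℓ =>
              ℓ.Z₀ = trefineDom D.F.L (D.cubesPerDir (k + 1)) Z ∧
                ℓ.P ⊆ bondsOfFineCubes hk (ℓ.Z₀.1 \ ℓ.fam.biUnion fun Y : (tsys 4 (D.F.L * D.cubesPerDir (k + 1))).Dom => Y.1) ∧
                (ℓ.Z₀.1 \ ℓ.fam.biUnion fun Y : (tsys 4 (D.F.L * D.cubesPerDir (k + 1))).Dom => Y.1).card ≤ 2 * ℓ.P.card,
            actOfLetters (PW D) ℂ (𝒵K D) (domK D) (JcK D) (VK D) (ℓK D k hk) (domEmb D.toTwoRuns (k + 1) Z) (InnerLabel.ofTorus hk ℓ) 0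
              ((0 : B13HistM (PW D)) + ((t : ℝ) : ℂ) • wW D))
            ((tgeometry 4 (D.cubesPerDir (k + 1))).cubes (X₀ (D.cubesPerDir (k + 1)))) ≠
      locE (tgeometry 4 (D.cubesPerDir (k + 1))).ι (tgeometry 4 (D.cubesPerDir (k + 1))).cubes
          (fun Z => ∑ ℓ ∈ (torusLabels hk Z).filter fun ℓ =>
              ℓ.Z₀ = trefineDom D.F.L (D.cubesPerDir (k + 1)) Z ∧
                ℓ.P ⊆ bondsOfFineCubes hk (ℓ.Z₀.1 \ ℓ.fam.biUnion fun Y : (tsys 4 (D.F.L * D.cubesPerDir (k + 1))).Dom => Y.1) ∧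
                (ℓ.Z₀.1 \ ℓ.fam.biUnion fun Y : (tsys 4 (D.F.L * D.cubesPerDir (k + 1))).Dom => Y.1).card ≤ 2 * ℓ.P.card,
            actOfLetters (PW D) ℂ (𝒵K D) (domK D) (JcK D) (VK D) (ℓK D k hk) (domEmb D.toTwoRuns (k + 1) Z) (InnerLabel.ofTorus hk ℓ) 0
              (0 : B13HistM (PW D)))
            ((tgeometry 4 (D.cubesPerDir (k + 1))).cubes (X₀ (D.cubesPerDir (k + 1)))) := by
  intro h
  have hb := pencil_value_pos_lt_one ht0 ht1
  have hpos : 0 < cK D k * (Real.exp (t * sW) - 1) := mul_pos (cK_pos D k) hb.1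
  have hn : ‖(fun Z => ∑ ℓ ∈ (torusLabels hk Z).filter fun ℓ =>
              ℓ.Z₀ = trefineDom D.F.L (D.cubesPerDir (k + 1)) Z ∧
                ℓ.P ⊆ bondsOfFineCubes hk (ℓ.Z₀.1 \ ℓ.fam.biUnion fun Y : (tsys 4 (D.F.L * D.cubesPerDir (k + 1))).Dom => Y.1) ∧
                (ℓ.Z₀.1 \ ℓ.fam.biUnion fun Y : (tsys 4 (D.F.L * D.cubesPerDir (k + 1))).Dom => Y.1).card ≤ 2 * ℓ.P.card,
            actOfLetters (PW D) ℂ (𝒵K D) (domK D) (JcK D) (VK D) (ℓK D k hk) (domEmb D.toTwoRuns (k + 1) Z) (InnerLabel.ofTorus hk ℓ) 0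
              ((0 : B13HistM (PW D)) + ((t : ℝ) : ℂ) • wW D)) (X₀ (D.cubesPerDir (k + 1)))‖ < 1 := by
    rw [filteredSum_pencil_real, Complex.norm_real, Real.norm_eq_abs, abs_of_pos hpos]
    calc cK D k * (Real.exp (t * sW) - 1) < 1 * 1 := mul_lt_mul'' (cK_lt_one D k) hb.2 (cK_pos D k).le hb.1.le
      _ = 1 := one_mul 1
  have h1 : cexp (locE (tgeometry 4 (D.cubesPerDir (k + 1))).ι (tgeometry 4 (D.cubesPerDir (k + 1))).cubes
          (fun Z => ∑ ℓ ∈ (torusLabels hk Z).filter fun ℓ =>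
              ℓ.Z₀ = trefineDom D.F.L (D.cubesPerDir (k + 1)) Z ∧
                ℓ.P ⊆ bondsOfFineCubes hk (ℓ.Z₀.1 \ ℓ.fam.biUnion fun Y : (tsys 4 (D.F.L * D.cubesPerDir (k + 1))).Dom => Y.1) ∧
                (ℓ.Z₀.1 \ ℓ.fam.biUnion fun Y : (tsys 4 (D.F.L * D.cubesPerDir (k + 1))).Dom => Y.1).card ≤ 2 * ℓ.P.card,
            actOfLetters (PW D) ℂ (𝒵K D) (domK D) (JcK D) (VK D) (ℓK D k hk) (domEmb D.toTwoRuns (k + 1) Z) (InnerLabel.ofTorus hk ℓ) 0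
              ((0 : B13HistM (PW D)) + ((t : ℝ) : ℂ) • wW D))
            ((tgeometry 4 (D.cubesPerDir (k + 1))).cubes (X₀ (D.cubesPerDir (k + 1))))) = 1 + (fun Z => ∑ ℓ ∈ (torusLabels hk Z).filter fun ℓ =>
              ℓ.Z₀ = trefineDom D.F.L (D.cubesPerDir (k + 1)) Z ∧
                ℓ.P ⊆ bondsOfFineCubes hk (ℓ.Z₀.1 \ ℓ.fam.biUnion fun Y : (tsys 4 (D.F.L * D.cubesPerDir (k + 1))).Dom => Y.1) ∧
                (ℓ.Z₀.1 \ ℓ.fam.biUnion fun Y : (tsys 4 (D.F.L * D.cubesPerDir (k + 1))).Dom => Y.1).card ≤ 2 * ℓ.P.card,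
            actOfLetters (PW D) ℂ (𝒵K D) (domK D) (JcK D) (VK D) (ℓK D k hk) (domEmb D.toTwoRuns (k + 1) Z) (InnerLabel.ofTorus hk ℓ) 0
              ((0 : B13HistM (PW D)) + ((t : ℝ) : ℂ) • wW D)) (X₀ (D.cubesPerDir (k + 1))) :=
    exp_locE_cube (D.cubesPerDir (k + 1)) hn
  have h0 : cexp (locE (tgeometry 4 (D.cubesPerDir (k + 1))).ι (tgeometry 4 (D.cubesPerDir (k + 1))).cubes
          (fun Z => ∑ ℓ ∈ (torusLabels hk Z).filter fun ℓ =>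
              ℓ.Z₀ = trefineDom D.F.L (D.cubesPerDir (k + 1)) Z ∧
                ℓ.P ⊆ bondsOfFineCubes hk (ℓ.Z₀.1 \ ℓ.fam.biUnion fun Y : (tsys 4 (D.F.L * D.cubesPerDir (k + 1))).Dom => Y.1) ∧
                (ℓ.Z₀.1 \ ℓ.fam.biUnion fun Y : (tsys 4 (D.F.L * D.cubesPerDir (k + 1))).Dom => Y.1).card ≤ 2 * ℓ.P.card,
            actOfLetters (PW D) ℂ (𝒵K D) (domK D) (JcK D) (VK D) (ℓK D k hk) (domEmb D.toTwoRuns (k + 1) Z) (InnerLabel.ofTorus hk ℓ) 0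
              (0 : B13HistM (PW D)))
            ((tgeometry 4 (D.cubesPerDir (k + 1))).cubes (X₀ (D.cubesPerDir (k + 1))))) = 1 + (fun Z => ∑ ℓ ∈ (torusLabels hk Z).filter fun ℓ =>
              ℓ.Z₀ = trefineDom D.F.L (D.cubesPerDir (k + 1)) Z ∧
                ℓ.P ⊆ bondsOfFineCubes hk (ℓ.Z₀.1 \ ℓ.fam.biUnion fun Y : (tsys 4 (D.F.L * D.cubesPerDir (k + 1))).Dom => Y.1) ∧
                (ℓ.Z₀.1 \ ℓ.fam.biUnion fun Y : (tsys 4 (D.F.L * D.cubesPerDir (k + 1))).Dom => Y.1).card ≤ 2 * ℓ.P.card,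
            actOfLetters (PW D) ℂ (𝒵K D) (domK D) (JcK D) (VK D) (ℓK D k hk) (domEmb D.toTwoRuns (k + 1) Z) (InnerLabel.ofTorus hk ℓ) 0
              (0 : B13HistM (PW D))) (X₀ (D.cubesPerDir (k + 1))) :=
    exp_locE_cube (D.cubesPerDir (k + 1)) (norm_filteredSum_lt_one D k hk).2
  have h' := congrArg cexp h
  rw [h1, h0, add_right_inj, filteredSum_pencil_real, filteredSum_undressed, Complex.ofReal_eq_zero] at h'
  exact hpos.ne' h'

/-! ## §8 HYPOTHESIS-FREE: the schema is inhabited at the substrate's driven two-run object of record at `SU(2)` -/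

/-- The standing-scale premiss at W58 P2 §7's `DW` (`F13`: `m = 1`; `K = 0`, `m′ = 0`) and `k = 0` is `0 + 1 + 0 ≤ 1 + 0`. [folklore] -/
theorem hk_DW : 0 + 1 + DW.m' ≤ DW.F.m + DW.K := by decide

open Classical in
/-- **N1a FIRES AT THE CARRIERS OF RECORD OF THE `SU(2)` OBJECT OF RECORD, HYPOTHESIS-FREE** (§6 at `D := DW`, `k := 0`, `U := UW`). [folklore] -/
theorem killWitnessEnd_fires_SU2 :
    ‖locE (tgeometry 4 (DW.cubesPerDir (0 + 1))).ι (tgeometry 4 (DW.cubesPerDir (0 + 1))).cubes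
          (fun Z => ∑ ℓ ∈ (torusLabels hk_DW Z).filter fun ℓ =>
              ℓ.Z₀ = trefineDom DW.F.L (DW.cubesPerDir (0 + 1)) Z ∧
                ℓ.P ⊆ bondsOfFineCubes hk_DW (ℓ.Z₀.1 \ ℓ.fam.biUnion fun Y : (tsys 4 (DW.F.L * DW.cubesPerDir (0 + 1))).Dom => Y.1) ∧
                (ℓ.Z₀.1 \ ℓ.fam.biUnion fun Y : (tsys 4 (DW.F.L * DW.cubesPerDir (0 + 1))).Dom => Y.1).card ≤ 2 * ℓ.P.card,
            actOfLetters (PW DW) ℂ (𝒵K DW) (domK DW) (JcK DW) (VK DW) (ℓK DW 0 hk_DW) (domEmb DW.toTwoRuns (0 + 1) Z)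
              (InnerLabel.ofTorus hk_DW ℓ) 0 ((0 : B13HistM (PW DW)) + wW DW))
            ((tgeometry 4 (DW.cubesPerDir (0 + 1))).cubes (X₀ (DW.cubesPerDir (0 + 1)))) -
        locE (tgeometry 4 (DW.cubesPerDir (0 + 1))).ι (tgeometry 4 (DW.cubesPerDir (0 + 1))).cubes
          (fun Z => ∑ ℓ ∈ (torusLabels hk_DW Z).filter fun ℓ =>
              ℓ.Z₀ = trefineDom DW.F.L (DW.cubesPerDir (0 + 1)) Z ∧
                ℓ.P ⊆ bondsOfFineCubes hk_DW (ℓ.Z₀.1 \ ℓ.fam.biUnion fun Y : (tsys 4 (DW.F.L * DW.cubesPerDir (0 + 1))).Dom => Y.1) ∧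
                (ℓ.Z₀.1 \ ℓ.fam.biUnion fun Y : (tsys 4 (DW.F.L * DW.cubesPerDir (0 + 1))).Dom => Y.1).card ≤ 2 * ℓ.P.card,
            actOfLetters (PW DW) ℂ (𝒵K DW) (domK DW) (JcK DW) (VK DW) (ℓK DW 0 hk_DW) (domEmb DW.toTwoRuns (0 + 1) Z)
              (InnerLabel.ofTorus hk_DW ℓ) 0 (0 : B13HistM (PW DW)))
            ((tgeometry 4 (DW.cubesPerDir (0 + 1))).cubes (X₀ (DW.cubesPerDir (0 + 1))))‖ ≤ 2 * K₀ 64 8 :=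
  killWitnessEnd_fires_closed DW 0 hk_DW UW

open Classical in
/-- … and its bounded quantity is NOT zero there. [folklore] -/
theorem killWitnessEnd_live_SU2 :
    locE (tgeometry 4 (DW.cubesPerDir (0 + 1))).ι (tgeometry 4 (DW.cubesPerDir (0 + 1))).cubes
          (fun Z => ∑ ℓ ∈ (torusLabels hk_DW Z).filter fun ℓ =>
              ℓ.Z₀ = trefineDom DW.F.L (DW.cubesPerDir (0 + 1)) Z ∧
                ℓ.P ⊆ bondsOfFineCubes hk_DW (ℓ.Z₀.1 \ ℓ.fam.biUnion fun Y : (tsys 4 (DW.F.L * DW.cubesPerDir (0 + 1))).Dom => Y.1) ∧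
                (ℓ.Z₀.1 \ ℓ.fam.biUnion fun Y : (tsys 4 (DW.F.L * DW.cubesPerDir (0 + 1))).Dom => Y.1).card ≤ 2 * ℓ.P.card,
            actOfLetters (PW DW) ℂ (𝒵K DW) (domK DW) (JcK DW) (VK DW) (ℓK DW 0 hk_DW) (domEmb DW.toTwoRuns (0 + 1) Z)
              (InnerLabel.ofTorus hk_DW ℓ) 0 ((0 : B13HistM (PW DW)) + wW DW))
            ((tgeometry 4 (DW.cubesPerDir (0 + 1))).cubes (X₀ (DW.cubesPerDir (0 + 1)))) ≠
      locE (tgeometry 4 (DW.cubesPerDir (0 + 1))).ι (tgeometry 4 (DW.cubesPerDir (0 + 1))).cubes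
          (fun Z => ∑ ℓ ∈ (torusLabels hk_DW Z).filter fun ℓ =>
              ℓ.Z₀ = trefineDom DW.F.L (DW.cubesPerDir (0 + 1)) Z ∧
                ℓ.P ⊆ bondsOfFineCubes hk_DW (ℓ.Z₀.1 \ ℓ.fam.biUnion fun Y : (tsys 4 (DW.F.L * DW.cubesPerDir (0 + 1))).Dom => Y.1) ∧
                (ℓ.Z₀.1 \ ℓ.fam.biUnion fun Y : (tsys 4 (DW.F.L * DW.cubesPerDir (0 + 1))).Dom => Y.1).card ≤ 2 * ℓ.P.card,
            actOfLetters (PW DW) ℂ (𝒵K DW) (domK DW) (JcK DW) (VK DW) (ℓK DW 0 hk_DW) (domEmb DW.toTwoRuns (0 + 1) Z)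
              (InnerLabel.ofTorus hk_DW ℓ) 0 (0 : B13HistM (PW DW)))
            ((tgeometry 4 (DW.cubesPerDir (0 + 1))).cubes (X₀ (DW.cubesPerDir (0 + 1)))) :=
  killWitnessEnd_live DW 0 hk_DW

end Summit.QuantumFields.BalabanUV.T4Continuum.NE1p.DressedSmallFieldRecordLabelsKillWitness

end
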